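/- Copyright: the b2b-balaban cell (near-miss cell 7), T⁴-continuum fan-out, lineage t4-ne7b-p1 (node U5c COUNT
member).  Released under the licence of the surrounding project. -/
import Mathlib.Analysis.SpecialFunctions.Pow.Real

/-!
# M5-1b (A2) — THE FLAT LEDGER: the lagged global sum `TOTAL·(1 − ε) ≤ YOUNG + FLOOR + FEE` (owner module of row
NE7b, lineage `t4-ne7b-p1` gen 43; re-open object (α), `SCOPE-alpha.md` v2.6, ruling R-OWNER-43-1 «THE FLAT ANCHOR
LEDGER» (d); PRE-POSITIONING ONLY)

Summits-side support leaf of the T⁴-continuum cell (rung (B)+1 on a FINITE torus only; NOT infinite volume, NOT the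
mass gap, NOT the Clay statement; NOT a proof of the spine estimate NE7b, which is the cell's OWN estimate, NOT PRINTED
and NOT PROVED).  [folklore] real arithmetic and finite sums over ABSTRACT per-step data (no geometry, no genealogy, no
constant of Bałaban's; Mathlib only); nothing printed is asserted, no `def`, no cite-tagged hypothesis, zero `sorry`.

WHY (ruling R-OWNER-43-1, journal «RULING R-OWNER-43-1»).  The flat anchor ledger reads the realised volume of a live
structure PER STEP `m` (A1 `HistoryBankingAnchors.card_MD_le_flat`): `V(m) ≤ Y(m) + c_A·R(m) + [j ≤ m]·(c_F·N(m−j) +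
ε·V(m−j))` — young images `Y`, one anchor fee `c_A = 561^d` per birth younger than the lag `j` (`R(m)` = the number of
births in `(m−j, m]`), one footprint floor `c_F = 1122^d` per component alive at the lag time (`N`), and a DECAYED
multiple `ε = 1122^d·16·21^d∕2^j` of the volume at the lag time.  Summed over the performed steps `m ≤ K` with
nonnegative per-step weights `u` whose growth over a lag is displayed (`u (t+i) ≤ L_u·u t` for `i ≤ j`), the lagged
terms are at most `L_u` times the un-lagged sums, so the volume cost obeys a GLOBAL reserve inequality
`TOTAL ≤ YOUNG + c_A·FEE + c_F·L_u·FLOOR + ε·L_u·TOTAL`, whence `TOTAL ≤ 2·(YOUNG + c_A·FEE + c_F·L_u·FLOOR)` as soon as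
`ε·L_u ≤ ½` — no per-component budget, no reserve bookkeeping along the pedigree.  THIS FILE is that arithmetic: §1
the lag shift `Σ_{j≤m≤K} u_m·F(m−j) ≤ L_u·Σ_{t≤K} u_t·F(t)` (`sum_lag_le`); §2 the recent-births exchange
`Σ_{m≤K} u_m·#{births t : t ≤ m < t+j} ≤ j·L_u·Σ_{t≤K} u_t·B(t)` (`sum_recent_le`); §3 **`flat_total_le`** — the
conclusion above from the per-step hypothesis, and `flat_total_le_births` with the fee exchanged.

WHAT IS *NOT* DONE HERE.  The per-step inequality itself (A1, geometry) and the junction A3 (the data `V, Y, N, R, B`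
read off a realised pedigree; `YOUNG` against the births' bookings by M5-1a, `FLOOR` against the covering windows by
`Gen.covers`, `FEE` against the births' window floors; the reading display `u_t·Φ ≤ E₂R_t^{q′}`).  No sanity section:
the statements are inequalities between finite sums of free real data, inhabited by zero data.  HONEST: arithmetic;
NE7b NOT proved; spine 0∕9.  HONEST DEPENDENCY (cell): continuum YM on T⁴ ⇐ BetaPertH ∧ nine spine estimates (0∕9
proved); BetaPertH ⇐ (D1) ∧ (D4) ∧ CAP+tail.  This file changes none of it.
-/

open Finset

namespace Summit.QuantumFields.BalabanUV.T4Continuum.HistoryBankingFlatLedger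

noncomputable section

/-! ## §1 The lag shift -/

/-- **THE LAG SHIFT.**  For nonnegative `u`, `F` and a displayed growth bound `u (t + j) ≤ L_u·u t`:
`Σ_{m ≤ K, j ≤ m} u_m·F(m − j) ≤ L_u·Σ_{t ≤ K} u_t·F(t)` (re-index `m = t + j`, drop the tail `t > K − j`). [folklore] -/
theorem sum_lag_le {u F : ℕ → ℝ} {K j : ℕ} {Lu : ℝ} (hu : ∀ t, 0 ≤ u t) (hF : ∀ t, 0 ≤ F t) (hLu0 : 0 ≤ Lu)
    (hLu : ∀ t, u (t + j) ≤ Lu * u t) :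
    ∑ m ∈ (Finset.range (K + 1)).filter (fun m => j ≤ m), u m * F (m - j) ≤
      Lu * ∑ t ∈ Finset.range (K + 1), u t * F t := by
  have hre : ∑ m ∈ (Finset.range (K + 1)).filter (fun m => j ≤ m), u m * F (m - j) =
      ∑ t ∈ Finset.range (K + 1 - j), u (t + j) * F t := by
    refine Finset.sum_nbij' (fun m => m - j) (fun t => t + j) ?_ ?_ ?_ ?_ ?_
    · intro m hm
      simp only [Finset.mem_filter, Finset.mem_range] at hm
      simp only [Finset.mem_range]; omega
    · intro t ht
      simp only [Finset.mem_range] at ht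
      simp only [Finset.mem_filter, Finset.mem_range]; omega
    · intro m hm
      simp only [Finset.mem_filter, Finset.mem_range] at hm
      show m - j + j = m; omega
    · intro t _
      show t + j - j = t; omega
    · intro m hm
      simp only [Finset.mem_filter, Finset.mem_range] at hm
      show u m * F (m - j) = u (m - j + j) * F (m - j)
      rw [Nat.sub_add_cancel hm.2]
  rw [hre, Finset.mul_sum]
  calc ∑ t ∈ Finset.range (K + 1 - j), u (t + j) * F t
      ≤ ∑ t ∈ Finset.range (K + 1 - j), Lu * (u t * F t) := by
        refine Finset.sum_le_sum fun t _ => ?_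
        rw [← mul_assoc]
        exact mul_le_mul_of_nonneg_right (hLu t) (hF t)
    _ ≤ ∑ t ∈ Finset.range (K + 1), Lu * (u t * F t) := by
        refine Finset.sum_le_sum_of_subset_of_nonneg (fun t ht => ?_) fun t _ _ =>
          mul_nonneg hLu0 (mul_nonneg (hu t) (hF t))
        simp only [Finset.mem_range] at ht ⊢; omega

/-- the lag shift with the lagged terms written as an indicator over all steps [folklore] -/
theorem sum_lag_ite_le {u F : ℕ → ℝ} {K j : ℕ} {Lu : ℝ} (hu : ∀ t, 0 ≤ u t) (hF : ∀ t, 0 ≤ F t) (hLu0 : 0 ≤ Lu)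
    (hLu : ∀ t, u (t + j) ≤ Lu * u t) :
    ∑ m ∈ Finset.range (K + 1), u m * (if j ≤ m then F (m - j) else 0) ≤
      Lu * ∑ t ∈ Finset.range (K + 1), u t * F t := by
  have h : ∑ m ∈ Finset.range (K + 1), u m * (if j ≤ m then F (m - j) else 0) =
      ∑ m ∈ (Finset.range (K + 1)).filter (fun m => j ≤ m), u m * F (m - j) := by
    rw [Finset.sum_filter]
    refine Finset.sum_congr rfl fun m _ => ?_
    split_ifs <;> simp
  rw [h]
  exact sum_lag_le hu hF hLu0 hLu

/-! ## §2 The recent-births exchange -/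

/-- **THE RECENT-BIRTHS EXCHANGE.**  With `B t ≥ 0` births at step `t` and the growth display `u (t + i) ≤ L_u·u t`
for `i < j`: the anchor fees of the births younger than the lag, `Σ_{m ≤ K} u_m·Σ_{t ≤ m < t + j} B t`, are at most
`j·L_u·Σ_{t ≤ K} u_t·B t` — each birth is recent for `j` steps. [folklore] -/
theorem sum_recent_le {u B : ℕ → ℝ} {K j : ℕ} {Lu : ℝ} (hu : ∀ t, 0 ≤ u t) (hB : ∀ t, 0 ≤ B t)
    (hLu : ∀ t i, i < j → u (t + i) ≤ Lu * u t) :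
    ∑ m ∈ Finset.range (K + 1), u m * (∑ t ∈ (Finset.range (m + 1)).filter (fun t => m < t + j), B t) ≤
      j * Lu * ∑ t ∈ Finset.range (K + 1), u t * B t := by
  -- write the double sum over the square `range (K+1) × range (K+1)` with an indicator
  have h1 : ∀ m ∈ Finset.range (K + 1),
      u m * (∑ t ∈ (Finset.range (m + 1)).filter (fun t => m < t + j), B t) =
        ∑ t ∈ Finset.range (K + 1), if t ≤ m ∧ m < t + j then u m * B t else 0 := by
    intro m hm
    rw [Finset.mem_range] at hm
    rw [Finset.mul_sum, Finset.sum_filter]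
    have hfl : (Finset.range (K + 1)).filter (fun t => t ≤ m) = Finset.range (m + 1) := by
      ext t; simp only [Finset.mem_filter, Finset.mem_range]; omega
    rw [← hfl, Finset.sum_filter]
    refine Finset.sum_congr rfl fun t _ => ?_
    by_cases htm : t ≤ m <;> by_cases hmt : m < t + j <;> simp [htm, hmt]
  rw [Finset.sum_congr rfl h1, Finset.sum_comm]
  -- for each birth step `t`, at most `j` recent steps, each weighing at most `L_u·u t`
  have h2 : ∀ t ∈ Finset.range (K + 1),
      (∑ m ∈ Finset.range (K + 1), if t ≤ m ∧ m < t + j then u m * B t else 0) ≤ j * Lu * (u t * B t) := by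
    intro t _
    calc (∑ m ∈ Finset.range (K + 1), if t ≤ m ∧ m < t + j then u m * B t else 0)
        = ∑ m ∈ (Finset.range (K + 1)).filter (fun m => t ≤ m ∧ m < t + j), u m * B t := by
          rw [Finset.sum_filter]
      _ ≤ ∑ m ∈ Finset.Ico t (t + j), u m * B t := by
          refine Finset.sum_le_sum_of_subset_of_nonneg (fun m hm => ?_) fun m _ _ => mul_nonneg (hu m) (hB t)
          simp only [Finset.mem_filter, Finset.mem_range] at hm
          rw [Finset.mem_Ico]; omega
      _ = ∑ i ∈ Finset.range j, u (t + i) * B t := by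
          rw [Finset.sum_Ico_eq_sum_range, Nat.add_sub_cancel_left]
      _ ≤ ∑ i ∈ Finset.range j, Lu * u t * B t := by
          refine Finset.sum_le_sum fun i hi => ?_
          rw [Finset.mem_range] at hi
          exact mul_le_mul_of_nonneg_right (hLu t i hi) (hB t)
      _ = j * Lu * (u t * B t) := by
          rw [Finset.sum_const, Finset.card_range, nsmul_eq_mul]; ring
  calc (∑ t ∈ Finset.range (K + 1), ∑ m ∈ Finset.range (K + 1), if t ≤ m ∧ m < t + j then u m * B t else 0)
      ≤ ∑ t ∈ Finset.range (K + 1), j * Lu * (u t * B t) := Finset.sum_le_sum h2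
    _ = j * Lu * ∑ t ∈ Finset.range (K + 1), u t * B t := by rw [Finset.mul_sum]

/-! ## §3 The flat total -/

/-- **THE FLAT LEDGER'S TOTAL** (ruling R-OWNER-43-1 (d)).  Abstract per-step data on the performed steps `m ≤ K`:
volumes `V ≥ 0`, young parts `Y`, component counts `N ≥ 0` (at the lag time), recent-birth counts `R`, nonnegative
weights `u` with the growth display `u (t + j) ≤ L_u·u t`, nonnegative constants `c_F`, `ε`; the PER-STEP INEQUALITY
`V m ≤ Y m + c_A·R m + [j ≤ m]·(c_F·N(m−j) + ε·V(m−j))` (A1); and the located smallness `ε·L_u ≤ ½` (the choice of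
the lag `j`).  Then `Σ_{m≤K} u_m·V m ≤ 2·(Σ u_m·Y m + c_A·Σ u_m·R m + c_F·L_u·Σ u_m·N m)`. [folklore] -/
theorem flat_total_le {u V Y N R : ℕ → ℝ} {K j : ℕ} {Lu cA cF ε : ℝ} (hu : ∀ t, 0 ≤ u t) (hV : ∀ t, 0 ≤ V t)
    (hN : ∀ t, 0 ≤ N t) (hLu0 : 0 ≤ Lu) (hLu : ∀ t, u (t + j) ≤ Lu * u t) (hcF : 0 ≤ cF) (hε : 0 ≤ ε)
    (hstep : ∀ m, m ≤ K → V m ≤ Y m + cA * R m + (if j ≤ m then cF * N (m - j) + ε * V (m - j) else 0))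
    (hsmall : ε * Lu ≤ 1 / 2) :
    ∑ m ∈ Finset.range (K + 1), u m * V m ≤
      2 * ((∑ m ∈ Finset.range (K + 1), u m * Y m) + cA * (∑ m ∈ Finset.range (K + 1), u m * R m)
        + cF * Lu * (∑ m ∈ Finset.range (K + 1), u m * N m)) := by
  set TOT := ∑ m ∈ Finset.range (K + 1), u m * V m with hTOT
  -- sum the per-step inequality with weights
  have h1 : TOT ≤ ∑ m ∈ Finset.range (K + 1),
      (u m * Y m + cA * (u m * R m) + (cF * (u m * (if j ≤ m then N (m - j) else 0))
        + ε * (u m * (if j ≤ m then V (m - j) else 0)))) := by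
    refine Finset.sum_le_sum fun m hm => ?_
    rw [Finset.mem_range] at hm
    have h := mul_le_mul_of_nonneg_left (hstep m (by omega)) (hu m)
    have e : u m * (Y m + cA * R m + (if j ≤ m then cF * N (m - j) + ε * V (m - j) else 0)) =
        u m * Y m + cA * (u m * R m) + (cF * (u m * (if j ≤ m then N (m - j) else 0))
          + ε * (u m * (if j ≤ m then V (m - j) else 0))) := by
      split_ifs <;> ring
    linarith
  rw [Finset.sum_add_distrib, Finset.sum_add_distrib, Finset.sum_add_distrib, ← Finset.mul_sum, ← Finset.mul_sum,
    ← Finset.mul_sum] at h1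
  -- the two lagged sums
  have hN' := sum_lag_ite_le (K := K) hu hN hLu0 hLu
  have hV' := sum_lag_ite_le (K := K) hu hV hLu0 hLu
  have h2 : cF * ∑ m ∈ Finset.range (K + 1), u m * (if j ≤ m then N (m - j) else 0) ≤
      cF * (Lu * ∑ t ∈ Finset.range (K + 1), u t * N t) := mul_le_mul_of_nonneg_left hN' hcF
  have h3 : ε * ∑ m ∈ Finset.range (K + 1), u m * (if j ≤ m then V (m - j) else 0) ≤ ε * (Lu * TOT) :=
    mul_le_mul_of_nonneg_left hV' hε
  have hTOT0 : 0 ≤ TOT := Finset.sum_nonneg fun m _ => mul_nonneg (hu m) (hV m)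
  have h4 : ε * (Lu * TOT) ≤ (1 / 2) * TOT := by
    rw [← mul_assoc]; exact mul_le_mul_of_nonneg_right hsmall hTOT0
  nlinarith

/-- **THE FLAT TOTAL WITH THE FEE EXCHANGED**: if moreover `R m = Σ_{t ≤ m < t+j} B t` counts the births younger than
the lag (`B t ≥ 0` births at step `t`, `c_A ≥ 0`) and the growth display holds for every lag `i ≤ j`, then
`Σ_{m≤K} u_m·V m ≤ 2·(Σ u_m·Y m + c_A·j·L_u·Σ u_t·B t + c_F·L_u·Σ u_m·N m)` — YOUNG, FEE per birth, FLOOR per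
component-step. [folklore] -/
theorem flat_total_le_births {u V Y N B : ℕ → ℝ} {K j : ℕ} {Lu cA cF ε : ℝ} (hu : ∀ t, 0 ≤ u t)
    (hV : ∀ t, 0 ≤ V t) (hN : ∀ t, 0 ≤ N t) (hB : ∀ t, 0 ≤ B t) (hLu0 : 0 ≤ Lu)
    (hLu : ∀ t i, i ≤ j → u (t + i) ≤ Lu * u t) (hcA : 0 ≤ cA) (hcF : 0 ≤ cF) (hε : 0 ≤ ε)
    (hstep : ∀ m, m ≤ K → V m ≤ Y m + cA * (∑ t ∈ (Finset.range (m + 1)).filter (fun t => m < t + j), B t)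
      + (if j ≤ m then cF * N (m - j) + ε * V (m - j) else 0))
    (hsmall : ε * Lu ≤ 1 / 2) :
    ∑ m ∈ Finset.range (K + 1), u m * V m ≤
      2 * ((∑ m ∈ Finset.range (K + 1), u m * Y m) + cA * (j * Lu * ∑ t ∈ Finset.range (K + 1), u t * B t)
        + cF * Lu * (∑ m ∈ Finset.range (K + 1), u m * N m)) := by
  have h1 := flat_total_le (R := fun m => ∑ t ∈ (Finset.range (m + 1)).filter (fun t => m < t + j), B t)
    hu hV hN hLu0 (fun t => hLu t j le_rfl) hcF hε hstep hsmall
  have h2 := sum_recent_le (K := K) hu hB fun t i hi => hLu t i hi.le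
  have h3 := mul_le_mul_of_nonneg_left h2 hcA
  linarith

end

end Summit.QuantumFields.BalabanUV.T4Continuum.HistoryBankingFlatLedger
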